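import Literature.NumberTheory.ModularForms.BinaryThetaEmbedding
import Mathlib.Topology.Algebra.Field
import Mathlib.Analysis.Convex.Basic
import HarnessLib

/-!
# Binary theta nulls: the transformation law `θ_B(γτ) = λ(γ)(cτ + d) θ_B(τ)` on `Γ₀(D)` with a
# unit constant `λ(γ)` (Hecke 1926; Schoeneberg 1939; from Lange's Thm. 3.3.9 in genus two)

Topic `Literature/NumberTheory/ModularForms`; namespace `Literature.NumberTheory.ModularForms.BinaryTheta`.
Everything here is PROVED (theorems only; no definition, no named fact).

For `B ∈ M₂(ℤ)` symmetric, positive definite, with EVEN diagonal (`B = 2Q`, `Q` an integral binary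
quadratic form), `D = det B`, and `γ = (a b; c d) ∈ SL₂(ℤ)` with `D ∣ c`, the genus-two Theta
Transformation Formula of the tree (`exists_riemannThetaChar_transform`, Lange 2023 Thm. 3.3.9 up to
the constant; `exists_unit_sq_riemannThetaChar_transform_const_eq_mul_det_denom`, `C² = u·det(γZ+δ)`)
applied to `M = symplEmbed B γ ∈ Sp₄(ℤ)` (`BinaryThetaEmbedding`) and `Z = τ·B` gives:

* `riemannThetaChar_thetaChar_symplEmbed_zero` — `M[0] ∈ ℤ⁴` (even diagonal), so the transformed theta
  null is again `ϑ[0; 0]`;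
* `det_denom_symplEmbed`, `denom_transpose_inv_mulVec` — `det(γ_M Z + δ) = (cτ+d)²`,
  `ᵗ(γ_M Z + δ)⁻¹ v = (cτ+d)⁻¹ v`;
* **`exists_unit_transform_const_eq`** — there is `λ = λ_B(γ) ∈ ℂ`, `|λ| = 1`, such that for EVERY
  `τ ∈ ℍ` the transformation constant is `C(τ·B, M) = λ · (cτ + d)`: `C² = u (cτ+d)²` pins `C/(cτ+d)`
  up to sign, and the sign cannot jump because `τ ↦ C(τ·B, M)` is continuous (the tree's
  `differentiableAt_riemannThetaChar_transform_quotient`) on the connected upper half plane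
  (Mathlib `IsPreconnected.eq_or_eq_neg_of_sq_eq`);
* **`exists_unit_riemannThetaChar_smul_transform`** — the law itself:
  `ϑ[0;0]((cτ+d)⁻¹v, (γτ)·B) = λ (cτ+d) e(πi ᵗv N_τ v) ϑ[0;0](v, τ·B)` for all `τ ∈ ℍ`, `v ∈ ℂ²`, and at
  `v = 0` the weight-one law of the THETA NULL `θ_B(τ) = Σ_{m∈ℤ²} e(πi τ ᵗmBm)`:
  `θ_B(γτ) = λ_B(γ) (cτ + d) θ_B(τ)` (`riemannThetaChar_zero_smul_transform`).

The value of `λ_B(γ)` (classically the Kronecker character `(disc/d)`, Hecke 1926 / Schoeneberg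
1939) is NOT computed here; the sequel pins it through Hecke's weight-one Eisenstein series.

## References

* E. Hecke, *Zur Theorie der elliptischen Modulfunktionen*, Math. Ann. 97 (1926), §3. [Hecke1926Modulfunktionen]
* A. N. Andrianov, V. G. Zhuravlev, *Modular Forms and Hecke Operators* (1995), Ch. 1 §3.3
  Thm. 3.13. [AndrianovZhuravlev2015]
* H. Lange, *Abelian Varieties over the Complex Numbers* (2023), §3.3.3 Thm. 3.3.9.
  [Lange2023AbelianVarietiesComplex]
-/

noncomputable section

open Matrix Complex Filter Topology Set
open scoped Real

open scoped MatrixGroups Matrix.Norms.Elementwise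

namespace Literature.NumberTheory.ModularForms.BinaryTheta

open Literature.Analysis.SpecialFunctions
open Literature.NumberTheory.Automorphic (siegelUpperHalfSpace mem_siegelUpperHalfSpace_iff)
open Literature.NumberTheory.ModularForms.SiegelUpperHalfSpace

variable {B : Matrix (Fin 2) (Fin 2) ℤ} {γ : SL(2, ℤ)}

/-! ### The transformed characteristic of the theta null is integral -/

/-- For `B` with even diagonal, `M[0] = (½ q d (adj B)₀; ½ a b (B)₀)` is an INTEGER vector, so
`ϑ[M[0]¹; M[0]²](w, Ω) = ϑ[0; 0](w, Ω)` (characteristics matter modulo `ℤ⁴` at `c = 0`, tree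
`riemannThetaChar_charShift`). [cite: Lange2023AbelianVarietiesComplex, §3.3.1 Lemma 3.3.1 (b)] -/
theorem riemannThetaChar_thetaChar_symplEmbed_zero (h00 : Even (B 0 0)) (h11 : Even (B 1 1))
    (γ : SL(2, ℤ)) (Ω : Matrix (Fin 2) (Fin 2) ℂ) (w : Fin 2 → ℂ) :
    riemannThetaChar (thetaCharFst (symplEmbed B γ) 0 0) (thetaCharSnd (symplEmbed B γ) 0 0) Ω w =
      riemannThetaChar 0 0 Ω w := by
  obtain ⟨k0, hk0⟩ := h00
  obtain ⟨k1, hk1⟩ := h11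
  set q : ℤ := (γ 1 0 : ℤ) / B.det with hq
  have h1 : thetaCharFst (symplEmbed B γ) 0 0 =
      (0 : Fin 2 → ℂ) + fun i => ((![q * (γ 1 1 : ℤ) * k1, q * (γ 1 1 : ℤ) * k0] i : ℤ) : ℂ) := by
    rw [thetaCharFst_symplEmbed]
    funext i
    fin_cases i
    · simp [hk1]; ring
    · simp [hk0]; ring
  have h2 : thetaCharSnd (symplEmbed B γ) 0 0 =
      (0 : Fin 2 → ℂ) + fun i => ((![(γ 0 0 : ℤ) * (γ 0 1 : ℤ) * k0, (γ 0 0 : ℤ) * (γ 0 1 : ℤ) * k1] i : ℤ) : ℂ) := by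
    rw [thetaCharSnd_symplEmbed]
    funext i
    fin_cases i
    · simp [hk0]; ring
    · simp [hk1]; ring
  rw [h1, h2, riemannThetaChar_charShift]
  simp

/-! ### The automorphy matrix: determinant and action on `v` -/

/-- `det(γ_M Z + δ) = (cτ + d)²` for `M = symplEmbed B γ`, `Z = τ·B`.
[cite: AndrianovZhuravlev2015, Ch. 1 §3.3 Prop. 3.12] -/
theorem det_denom_symplEmbed (hB : B.IsSymm) (hγ : B.det ∣ (γ 1 0 : ℤ)) (τ : ℂ) :
    (denom ((symplEmbed B γ).map ((↑) : ℤ → ℂ)) (τ • B.map ((↑) : ℤ → ℂ))).det =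
      (((γ 1 0 : ℤ) : ℂ) * τ + ((γ 1 1 : ℤ) : ℂ)) ^ 2 := by
  rw [denom_symplEmbed hB hγ τ, Matrix.det_fin_two]
  simp; ring

/-- `ᵗ(γ_M Z + δ)⁻¹ v = (cτ + d)⁻¹ · v` for `M = symplEmbed B γ`, `Z = τ·B`, `cτ + d ≠ 0`.
[cite: AndrianovZhuravlev2015, Ch. 1 §3.3 Prop. 3.12] -/
theorem denom_transpose_inv_mulVec (hB : B.IsSymm) (hγ : B.det ∣ (γ 1 0 : ℤ)) {τ : ℂ}
    (hcd : ((γ 1 0 : ℤ) : ℂ) * τ + ((γ 1 1 : ℤ) : ℂ) ≠ 0) (v : Fin 2 → ℂ) :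
    (denom ((symplEmbed B γ).map ((↑) : ℤ → ℂ)) (τ • B.map ((↑) : ℤ → ℂ)))ᵀ⁻¹ *ᵥ v =
      (((γ 1 0 : ℤ) : ℂ) * τ + ((γ 1 1 : ℤ) : ℂ))⁻¹ • v := by
  set w : ℂ := ((γ 1 0 : ℤ) : ℂ) * τ + ((γ 1 1 : ℤ) : ℂ) with hw
  have h1 : (denom ((symplEmbed B γ).map ((↑) : ℤ → ℂ)) (τ • B.map ((↑) : ℤ → ℂ)))ᵀ =
      w • (1 : Matrix (Fin 2) (Fin 2) ℂ) := by
    rw [denom_symplEmbed hB hγ τ]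
    ext i j; fin_cases i <;> fin_cases j <;> simp [hw]
  have hinv : (w • (1 : Matrix (Fin 2) (Fin 2) ℂ))⁻¹ = w⁻¹ • (1 : Matrix (Fin 2) (Fin 2) ℂ) := by
    refine Matrix.inv_eq_left_inv ?_
    rw [Matrix.smul_mul, Matrix.mul_smul, Matrix.one_mul, smul_smul, inv_mul_cancel₀ hcd, one_smul]
  rw [h1, hinv, Matrix.smul_mulVec, Matrix.one_mulVec]

/-! ### The constant along a line `τ ↦ τ·P` is a constant multiple of `√det(γ_M Z + δ)` -/

/-- **Continuity pins the sign.**  Let `M ∈ Sp₄(ℤ)` and let `τ ↦ τ·P` (`Im τ > 0`) be a line in `𝔥₂`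
along which `det(γ_M (τ·P) + δ) = ℓ(τ)²` for a continuous nonvanishing `ℓ`.  Then there is ONE unit
`Λ ∈ ℂ` with `C(τ·P, M) = Λ · ℓ(τ)` for every `τ ∈ ℍ`, `C(Z, M)` the constant of the genus-two
transformation law at characteristic `0` (tree `exists_riemannThetaChar_transform`).  Proof:
`C² = u(M)·det` (`exists_unit_sq_riemannThetaChar_transform_const_eq_mul_det_denom`) gives
`(C/ℓ)² = u`; `τ ↦ C(τ·P, M)` is continuous (locally the holomorphic quotient of
`differentiableAt_riemannThetaChar_transform_quotient`), and a continuous square root of a constant on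
the connected upper half plane is constant (`IsPreconnected.eq_or_eq_neg_of_sq_eq`).
[cite: Lange2023AbelianVarietiesComplex, §3.3.3 Thm. 3.3.9] -/
theorem exists_unit_transform_const_eq_mul {M : Matrix (Fin 2 ⊕ Fin 2) (Fin 2 ⊕ Fin 2) ℤ}
    (hM : M ∈ Matrix.symplecticGroup (Fin 2) ℤ) {P : Matrix (Fin 2) (Fin 2) ℂ}
    (hP : ∀ τ : ℂ, 0 < τ.im → τ • P ∈ siegelUpperHalfSpace 2) {ℓ : ℂ → ℂ}
    (hℓc : ContinuousOn ℓ {τ : ℂ | 0 < τ.im}) (hℓ0 : ∀ τ : ℂ, 0 < τ.im → ℓ τ ≠ 0)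
    (hdet : ∀ τ : ℂ, 0 < τ.im → (denom (M.map ((↑) : ℤ → ℂ)) (τ • P)).det = ℓ τ ^ 2) :
    ∃ Λ : ℂ, ‖Λ‖ = 1 ∧ ∀ τ : ℂ, 0 < τ.im → ∀ C : ℂ,
      (∀ v : Fin 2 → ℂ,
        riemannThetaChar (thetaCharFst M 0 0) (thetaCharSnd M 0 0)
            (moeb (M.map ((↑) : ℤ → ℂ)) (τ • P)) ((denom (M.map ((↑) : ℤ → ℂ)) (τ • P))ᵀ⁻¹ *ᵥ v) =
          C * cexp (π * I * (v ⬝ᵥ ((denom (M.map ((↑) : ℤ → ℂ)) (τ • P))⁻¹ *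
                (M.map ((↑) : ℤ → ℂ)).toBlocks₂₁) *ᵥ v)) * riemannThetaChar 0 0 (τ • P) v) →
      C = Λ * ℓ τ := by
  set Pm : Matrix (Fin 2 ⊕ Fin 2) (Fin 2 ⊕ Fin 2) ℂ := M.map ((↑) : ℤ → ℂ) with hPm
  -- the law as a predicate, the chosen constants, and the unit `u`
  set law : ℂ → ℂ → Prop := fun τ C => ∀ v : Fin 2 → ℂ,
    riemannThetaChar (thetaCharFst M 0 0) (thetaCharSnd M 0 0) (moeb Pm (τ • P)) ((denom Pm (τ • P))ᵀ⁻¹ *ᵥ v) =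
      C * cexp (π * I * (v ⬝ᵥ ((denom Pm (τ • P))⁻¹ * Pm.toBlocks₂₁) *ᵥ v)) *
        riemannThetaChar 0 0 (τ • P) v with hlaw
  have hex : ∀ τ : ℂ, 0 < τ.im → ∃ C : ℂ, C ≠ 0 ∧ law τ C := fun τ hτ =>
    exists_riemannThetaChar_transform hM (hP τ hτ) 0 0
  have huniq : ∀ τ : ℂ, 0 < τ.im → ∀ C C' : ℂ, law τ C → law τ C' → C = C' := by
    intro τ hτ C C' hC hC'
    exact riemannThetaChar_transform_const_unique (hP τ hτ) 0 0
      (e := fun v => cexp (π * I * (v ⬝ᵥ ((denom Pm (τ • P))⁻¹ * Pm.toBlocks₂₁) *ᵥ v)))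
      (fun v => Complex.exp_ne_zero _) (fun v => by rw [← hC v, ← hC' v])
  obtain ⟨u, hu1, hu⟩ := exists_unit_sq_riemannThetaChar_transform_const_eq_mul_det_denom hM
  -- the function `f(τ) = C(τ)/ℓ(τ)` on the upper half plane
  classical
  set Cf : ℂ → ℂ := fun τ => if hτ : 0 < τ.im then Classical.choose (hex τ hτ) else 0 with hCf
  have hCf_law : ∀ τ : ℂ, ∀ hτ : 0 < τ.im, law τ (Cf τ) := fun τ hτ => by
    simp only [hCf, dif_pos hτ]
    exact (Classical.choose_spec (hex τ hτ)).2
  set f : ℂ → ℂ := fun τ => Cf τ / ℓ τ with hfdef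
  have hsq : ∀ τ : ℂ, 0 < τ.im → f τ ^ 2 = u := by
    intro τ hτ
    have h := hu (τ • P) (hP τ hτ) (Cf τ) (hCf_law τ hτ)
    rw [hdet τ hτ] at h
    simp only [hfdef, div_pow]
    rw [h, mul_div_assoc, div_self (pow_ne_zero 2 (hℓ0 τ hτ)), mul_one]
  -- continuity of `f` on the upper half plane
  have hcont : ContinuousOn f {τ : ℂ | 0 < τ.im} := by
    intro τ₀ hτ₀
    have hτ₀' : 0 < τ₀.im := hτ₀
    have hZ₀ := hP τ₀ hτ₀'
    obtain ⟨c₀, hc₀, hY₀⟩ := exists_pos_mul_sum_sq_le_of_posDef_im _ hZ₀.2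
    obtain ⟨v₀, hv₀⟩ := exists_riemannTheta_ne_zero (τ₀ • P) hc₀ hY₀
    -- the quotient, differentiable in `Z` at `τ₀ • P`
    have hQ := differentiableAt_riemannThetaChar_transform_quotient hM hZ₀ v₀ hv₀
    have hZd : DifferentiableAt ℂ (fun τ : ℂ => τ • P) τ₀ := differentiableAt_id.smul_const P
    have hQτ := hQ.comp τ₀ hZd
    -- `ϑ(v₀, τ • P)` is continuous in `τ`, hence nonzero near `τ₀`
    have hθd : DifferentiableAt ℂ ((fun Z : Matrix (Fin 2) (Fin 2) ℂ => riemannTheta Z v₀) ∘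
        fun τ : ℂ => τ • P) τ₀ :=
      (differentiableAt_riemannTheta_omega (τ₀ • P) hc₀ hY₀ v₀).comp τ₀ hZd
    have hθ : ContinuousAt (fun τ : ℂ => riemannTheta (τ • P) v₀) τ₀ := hθd.continuousAt
    have hev : ∀ᶠ τ in 𝓝 τ₀, 0 < τ.im ∧ riemannTheta (τ • P) v₀ ≠ 0 := by
      refine Filter.Eventually.and ?_ (hθ.eventually_ne hv₀)
      exact Complex.continuous_im.continuousAt.eventually (Ioi_mem_nhds hτ₀')
    have heq : f =ᶠ[𝓝 τ₀] fun τ => (riemannThetaChar (thetaCharFst M 0 0) (thetaCharSnd M 0 0)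
        (moeb Pm (τ • P)) ((denom Pm (τ • P))ᵀ⁻¹ *ᵥ v₀) *
        cexp (-(π * I * (v₀ ⬝ᵥ ((denom Pm (τ • P))⁻¹ * Pm.toBlocks₂₁) *ᵥ v₀))) *
        (riemannTheta (τ • P) v₀)⁻¹) / ℓ τ := by
      filter_upwards [hev] with τ hτ
      simp only [hfdef]
      rw [riemannThetaChar_transform_const_eq_quotient (hCf_law τ hτ.1) hτ.2]
    refine (ContinuousAt.congr ?_ heq.symm).continuousWithinAt
    exact hQτ.continuousAt.div (hℓc.continuousAt (IsOpen.mem_nhds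
      (isOpen_lt continuous_const Complex.continuous_im) hτ₀')) (hℓ0 τ₀ hτ₀')
  -- `f² = u` on a preconnected set ⇒ `f` is constant
  have hpre : IsPreconnected {τ : ℂ | 0 < τ.im} :=
    (convex_halfSpace_im_gt (0 : ℝ)).isPreconnected
  set s : ℂ := f I with hsdef
  have hI : (0 : ℝ) < Complex.I.im := by simp
  have hs2 : s ^ 2 = u := hsq I hI
  have hs0 : s ≠ 0 := by
    intro h; rw [h, zero_pow two_ne_zero] at hs2
    rw [← hs2, norm_zero] at hu1; exact zero_ne_one hu1
  have hcases := hpre.eq_or_eq_neg_of_sq_eq hcont continuousOn_const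
    (g := fun _ => s) (fun τ hτ => by simp only [Pi.pow_apply]; rw [hsq τ hτ, hs2]) (fun _ => hs0)
  have hfs : ∀ τ : ℂ, 0 < τ.im → f τ = s := by
    rcases hcases with h | h
    · exact fun τ hτ => h hτ
    · exfalso
      have h' := h (x := I) hI
      simp only [Pi.neg_apply] at h'
      exact hs0 (by linear_combination h' / 2)
  refine ⟨s, ?_, fun τ hτ C hC => ?_⟩
  · have : ‖s‖ ^ 2 = 1 := by rw [← norm_pow, hs2, hu1]
    nlinarith [norm_nonneg s]
  · have hCC : C = Cf τ := huniq τ hτ C (Cf τ) hC (hCf_law τ hτ)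
    have := hfs τ hτ
    simp only [hfdef] at this
    rw [hCC, ← this, div_mul_cancel₀ _ (hℓ0 τ hτ)]

/-- **`C(τ·B, M) = λ_B(γ) · (cτ + d)` with `|λ_B(γ)| = 1`, uniformly in `τ ∈ ℍ`**, for
`M = symplEmbed B γ` (`B` symmetric positive definite, `det B ∣ c`): the case `P = B`,
`ℓ(τ) = cτ + d` of `exists_unit_transform_const_eq_mul` (`det(γ_M Z + δ) = (cτ+d)²`).
[cite: Lange2023AbelianVarietiesComplex, §3.3.3 Thm. 3.3.9] [cite: AndrianovZhuravlev2015, Ch. 1 §3.3 Thm. 3.13] -/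
theorem exists_unit_transform_const_eq (hB : B.IsSymm)
    (hpos : (B.map (Int.cast : ℤ → ℝ)).PosDef) (hγ : B.det ∣ (γ 1 0 : ℤ)) :
    ∃ Λ : ℂ, ‖Λ‖ = 1 ∧ ∀ τ : ℂ, 0 < τ.im → ∀ C : ℂ,
      (∀ v : Fin 2 → ℂ,
        riemannThetaChar (thetaCharFst (symplEmbed B γ) 0 0) (thetaCharSnd (symplEmbed B γ) 0 0)
            (moeb ((symplEmbed B γ).map ((↑) : ℤ → ℂ)) (τ • B.map ((↑) : ℤ → ℂ)))
            ((denom ((symplEmbed B γ).map ((↑) : ℤ → ℂ)) (τ • B.map ((↑) : ℤ → ℂ)))ᵀ⁻¹ *ᵥ v) =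
          C * cexp (π * I * (v ⬝ᵥ ((denom ((symplEmbed B γ).map ((↑) : ℤ → ℂ)) (τ • B.map ((↑) : ℤ → ℂ)))⁻¹ *
                ((symplEmbed B γ).map ((↑) : ℤ → ℂ)).toBlocks₂₁) *ᵥ v)) *
            riemannThetaChar 0 0 (τ • B.map ((↑) : ℤ → ℂ)) v) →
      C = Λ * (((γ 1 0 : ℤ) : ℂ) * τ + ((γ 1 1 : ℤ) : ℂ)) :=
  exists_unit_transform_const_eq_mul (symplEmbed_mem hB hγ)
    (fun _ hτ => smul_mem_siegelUpperHalfSpace hB hpos hτ)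
    (((continuous_const.mul continuous_id).add continuous_const).continuousOn)
    (fun _ hτ => denom_ne_zero γ hτ) (fun τ _ => det_denom_symplEmbed hB hγ τ)

/-! ### The transformation laws -/

/-- **Transformation law of binary theta series with characteristic under `Γ₀(D)`** (all
characteristics, one unit constant): for `B` symmetric positive definite with even diagonal,
`γ = (a' b'; c d) ∈ SL₂(ℤ)` with `det B ∣ c`, `M = symplEmbed B γ`, there is `λ = λ_B(γ)`, `|λ| = 1`,
with `ϑ[M[c]¹; M[c]²]((cτ+d)⁻¹v, (γτ)·B) = λ (cτ+d) e(πi k(M, c)) e(πi ᵗv N_τ v) ϑ[c¹; c²](v, τ·B)` for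
all `τ ∈ ℍ`, `v ∈ ℂ²` and all complex characteristics `c = (c¹, c²)`, where `k` is the tree's
`thetaTransformPhase` and `N_τ = (γ_M Z + δ)⁻¹γ_M`. [cite: Lange2023AbelianVarietiesComplex, §3.3.3 Thm. 3.3.9]
[cite: AndrianovZhuravlev2015, Ch. 1 §3.3 Thm. 3.13] -/
theorem exists_unit_riemannThetaChar_transform (hB : B.IsSymm)
    (hpos : (B.map (Int.cast : ℤ → ℝ)).PosDef) (hγ : B.det ∣ (γ 1 0 : ℤ)) :
    ∃ Λ : ℂ, ‖Λ‖ = 1 ∧ ∀ τ : ℂ, 0 < τ.im → ∀ (a b v : Fin 2 → ℂ),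
      riemannThetaChar (thetaCharFst (symplEmbed B γ) a b) (thetaCharSnd (symplEmbed B γ) a b)
          (((((γ 0 0 : ℤ) : ℂ) * τ + ((γ 0 1 : ℤ) : ℂ)) / (((γ 1 0 : ℤ) : ℂ) * τ + ((γ 1 1 : ℤ) : ℂ))) •
            B.map ((↑) : ℤ → ℂ))
          ((((γ 1 0 : ℤ) : ℂ) * τ + ((γ 1 1 : ℤ) : ℂ))⁻¹ • v) =
        Λ * (((γ 1 0 : ℤ) : ℂ) * τ + ((γ 1 1 : ℤ) : ℂ)) *
          cexp (π * I * thetaTransformPhase (symplEmbed B γ) a b) *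
          cexp (π * I * (v ⬝ᵥ ((denom ((symplEmbed B γ).map ((↑) : ℤ → ℂ)) (τ • B.map ((↑) : ℤ → ℂ)))⁻¹ *
                ((symplEmbed B γ).map ((↑) : ℤ → ℂ)).toBlocks₂₁) *ᵥ v)) *
            riemannThetaChar a b (τ • B.map ((↑) : ℤ → ℂ)) v := by
  obtain ⟨Λ, hΛ, hC⟩ := exists_unit_transform_const_eq hB hpos hγ
  have hM : symplEmbed B γ ∈ Matrix.symplecticGroup (Fin 2) ℤ := symplEmbed_mem hB hγ
  refine ⟨Λ, hΛ, fun τ hτ a b v => ?_⟩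
  have hZ := smul_mem_siegelUpperHalfSpace hB hpos hτ
  have hcd := denom_ne_zero γ hτ
  obtain ⟨C, -, hCv⟩ := exists_riemannThetaChar_transform hM hZ a b
  obtain ⟨C₀, -, hC₀⟩ := exists_riemannThetaChar_transform hM hZ 0 0
  have hCC₀ := riemannThetaChar_transform_const_eq hM hZ a b hCv hC₀
  have hC₀' := hC τ hτ C₀ hC₀
  have h := hCv v
  rw [moeb_symplEmbed hB hγ hcd, denom_transpose_inv_mulVec hB hγ hcd] at h
  rw [h, hCC₀, hC₀']

/-- **The theta null law**: `ϑ[0; 0]((cτ+d)⁻¹v, (γτ)·B) = λ_B(γ)(cτ+d) e(πi ᵗv N_τ v) ϑ[0; 0](v, τ·B)`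
(`B` symmetric positive definite with EVEN diagonal, `det B ∣ c`), with the unit `λ_B(γ)` of
`exists_unit_riemannThetaChar_transform`. [cite: AndrianovZhuravlev2015, Ch. 1 §3.3 Thm. 3.13]
[cite: Hecke1926Modulfunktionen, §3] -/
theorem exists_unit_riemannThetaChar_zero_transform (hB : B.IsSymm) (h00 : Even (B 0 0))
    (h11 : Even (B 1 1)) (hpos : (B.map (Int.cast : ℤ → ℝ)).PosDef) (hγ : B.det ∣ (γ 1 0 : ℤ)) :
    ∃ Λ : ℂ, ‖Λ‖ = 1 ∧ (∀ τ : ℂ, 0 < τ.im → ∀ (a b v : Fin 2 → ℂ),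
      riemannThetaChar (thetaCharFst (symplEmbed B γ) a b) (thetaCharSnd (symplEmbed B γ) a b)
          (((((γ 0 0 : ℤ) : ℂ) * τ + ((γ 0 1 : ℤ) : ℂ)) / (((γ 1 0 : ℤ) : ℂ) * τ + ((γ 1 1 : ℤ) : ℂ))) •
            B.map ((↑) : ℤ → ℂ))
          ((((γ 1 0 : ℤ) : ℂ) * τ + ((γ 1 1 : ℤ) : ℂ))⁻¹ • v) =
        Λ * (((γ 1 0 : ℤ) : ℂ) * τ + ((γ 1 1 : ℤ) : ℂ)) *
          cexp (π * I * thetaTransformPhase (symplEmbed B γ) a b) *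
          cexp (π * I * (v ⬝ᵥ ((denom ((symplEmbed B γ).map ((↑) : ℤ → ℂ)) (τ • B.map ((↑) : ℤ → ℂ)))⁻¹ *
                ((symplEmbed B γ).map ((↑) : ℤ → ℂ)).toBlocks₂₁) *ᵥ v)) *
            riemannThetaChar a b (τ • B.map ((↑) : ℤ → ℂ)) v) ∧
      ∀ τ : ℂ, 0 < τ.im → ∀ v : Fin 2 → ℂ,
      riemannThetaChar 0 0
          (((((γ 0 0 : ℤ) : ℂ) * τ + ((γ 0 1 : ℤ) : ℂ)) / (((γ 1 0 : ℤ) : ℂ) * τ + ((γ 1 1 : ℤ) : ℂ))) •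
            B.map ((↑) : ℤ → ℂ))
          ((((γ 1 0 : ℤ) : ℂ) * τ + ((γ 1 1 : ℤ) : ℂ))⁻¹ • v) =
        Λ * (((γ 1 0 : ℤ) : ℂ) * τ + ((γ 1 1 : ℤ) : ℂ)) *
          cexp (π * I * (v ⬝ᵥ ((denom ((symplEmbed B γ).map ((↑) : ℤ → ℂ)) (τ • B.map ((↑) : ℤ → ℂ)))⁻¹ *
                ((symplEmbed B γ).map ((↑) : ℤ → ℂ)).toBlocks₂₁) *ᵥ v)) *
            riemannThetaChar 0 0 (τ • B.map ((↑) : ℤ → ℂ)) v := by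
  obtain ⟨Λ, hΛ, h⟩ := exists_unit_riemannThetaChar_transform hB hpos hγ
  refine ⟨Λ, hΛ, h, fun τ hτ v => ?_⟩
  have h0 := h τ hτ 0 0 v
  rw [riemannThetaChar_thetaChar_symplEmbed_zero h00 h11, thetaTransformPhase_zero_zero, mul_zero,
    Complex.exp_zero, mul_one] at h0
  exact h0

/-- **Weight-one law of the theta null** `θ_B(τ) = ϑ[0;0](0, τ·B) = Σ_{m ∈ ℤ²} e(πi τ ᵗmBm)`:
`θ_B(γτ) = λ_B(γ) (cτ + d) θ_B(τ)` for `γ ∈ SL₂(ℤ)` with `det B ∣ c` (Hecke 1926 §3; Schoeneberg 1939;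
Andrianov–Zhuravlev Thm. 3.13 for `g = 1`), with `|λ_B(γ)| = 1` the same unit as in
`exists_unit_riemannThetaChar_zero_transform`. [cite: AndrianovZhuravlev2015, Ch. 1 §3.3 Thm. 3.13]
[cite: Hecke1926Modulfunktionen, §3] -/
theorem riemannThetaChar_zero_smul_transform {Λ : ℂ} (hΛ : ∀ τ : ℂ, 0 < τ.im → ∀ v : Fin 2 → ℂ,
      riemannThetaChar 0 0
          (((((γ 0 0 : ℤ) : ℂ) * τ + ((γ 0 1 : ℤ) : ℂ)) / (((γ 1 0 : ℤ) : ℂ) * τ + ((γ 1 1 : ℤ) : ℂ))) •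
            B.map ((↑) : ℤ → ℂ))
          ((((γ 1 0 : ℤ) : ℂ) * τ + ((γ 1 1 : ℤ) : ℂ))⁻¹ • v) =
        Λ * (((γ 1 0 : ℤ) : ℂ) * τ + ((γ 1 1 : ℤ) : ℂ)) *
          cexp (π * I * (v ⬝ᵥ ((denom ((symplEmbed B γ).map ((↑) : ℤ → ℂ)) (τ • B.map ((↑) : ℤ → ℂ)))⁻¹ *
                ((symplEmbed B γ).map ((↑) : ℤ → ℂ)).toBlocks₂₁) *ᵥ v)) *
            riemannThetaChar 0 0 (τ • B.map ((↑) : ℤ → ℂ)) v)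
    {τ : ℂ} (hτ : 0 < τ.im) :
    riemannThetaChar 0 0
        (((((γ 0 0 : ℤ) : ℂ) * τ + ((γ 0 1 : ℤ) : ℂ)) / (((γ 1 0 : ℤ) : ℂ) * τ + ((γ 1 1 : ℤ) : ℂ))) •
          B.map ((↑) : ℤ → ℂ)) 0 =
      Λ * (((γ 1 0 : ℤ) : ℂ) * τ + ((γ 1 1 : ℤ) : ℂ)) * riemannThetaChar 0 0 (τ • B.map ((↑) : ℤ → ℂ)) 0 := by
  have h := hΛ τ hτ 0
  simp only [smul_zero, Matrix.mulVec_zero, dotProduct_zero, mul_zero, Complex.exp_zero, mul_one] at h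
  exact h

end Literature.NumberTheory.ModularForms.BinaryTheta

end
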